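import Literature.Geometry.Lorentzian.KerrWaveEnergyProofs
import HarnessLib

/-!
# The time derivative `Tψ = ∂_{t*}ψ` of waves on Kerr: commutation with `□_g`, admissibility,
# finiteness of the second-order initial energy

(family `gr`, infrastructure for **gr.S24**; namespaces `Literature.Geometry.Lorentzian`,
`Literature.Geometry.Lorentzian.Kerr`)

`BlackHoles.lean` vendors the Dafermos–Rodnianski–Shlapentokh-Rothman (DRSR, arXiv:1402.7034 =
Ann. of Math. 183 (2016)) statements about solutions of `□_g ψ = 0` on the subextremal Kerr
exterior for the class `IsAdmissibleKerrWave M a ψ` (smooth solutions on the ingoing Kerr–Schild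
exterior chart `Kerr.exterior M a = {r > r₊}` whose data on the slice `{t* = 0} ∩ {r > r₊}` are
supported in a compact set `K`). DRSR's higher-order statements (Thm. 3.2) are obtained by
commuting the equation with the stationary Killing field `T = ∂_{t*}` (§2.2.2). This file provides
that commutation for the vendored class, entirely in Kerr–Schild coordinates:

* `timeDeriv ψ` — `Tψ = ∂_{t*}ψ` for `ψ : U → ℝ` on an open `U ⊆ E4` (the partial derivative of
  the extension by zero `ψ̃`, which agrees with `ψ` on `U`); `contMDiff_timeDeriv`.
* `Kerr.coordWave_partial_zero_comm`, `Kerr.dalembertian_timeDeriv_eq_zero` — **`□_g (Tψ) = 0`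
  whenever `□_g ψ = 0`** on a chart domain `Kerr.region a r₀`: by the divergence form
  `□_g ψ = ∑_μ ∂_μ(∑_ν g^{μν} ∂_νψ̃)` (`Kerr.dalembertian_eq_divergence`, `det g = −1`),
  stationarity `∂_{t*} g^{μν} = 0` (`Kerr.fderiv_inverseMetric_basisVector_zero`) and the symmetry
  of second derivatives.
* `Kerr.fderiv_fderiv_extend_eq_zero_of_data` — for a solution with `M ≥ 0`, **all second
  derivatives `D²ψ̃` vanish at the points of the slice outside `K`**: spatial derivatives of the
  vanishing data vanish, mixed ones by symmetry, and `∂_0²ψ̃ = 0` from the equation, in which only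
  `g^{00} ∂_0²ψ̃` survives, `g^{00} = −1 − 2H ≠ 0` (`Kerr.inverseMetric_zero_zero`).
* `IsAdmissibleKerrWave.timeDeriv` — hence **`Tψ` is again an admissible wave**, with the same `K`
  (no finite-speed-of-propagation argument is needed).
* `IsAdmissibleKerrWave.sliceSobolevEnergy_two_lt_top` — **the second-order coordinate energy
  `E₂[ψ](0) = sliceSobolevEnergy … ψ 0 2 0 univ` of the data of an admissible wave is finite**
  (the integrand is continuous on `K` and vanishes off `K` by the previous item). This is the
  hypothesis `hE` of `drsr_wave_integrated_decay_kerr.frequently_lt` (`KerrWaveDecay.lean`), now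
  discharged for every admissible wave.
* `energyIntegrand`, `measurable_energyIntegrand`, `measurable_localSliceEnergy` — the space-time
  integrand `(t, y) ↦ 𝟙_U ∑_μ (∂_μψ̃)²(t, y)` of the coordinate energies of `WeightedNorms.lean` is
  jointly Borel measurable for *every* `ψ` (Mathlib's `measurable_fderiv_apply_const`), so
  `τ ↦ E_loc(τ, R)` is measurable and Tonelli applies.

Auxiliary calculus on `E4` (`fderiv_fderiv_apply_comm`: partial derivatives commute for `C²`
functions; `fderiv_apply_eq_zero_of_eventually_eq_zero`; continuity of `(t, y) ↦ (t, y)`).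
The companion file `KerrLocalEnergyDecay.lean` uses these to derive DRSR's local energy decay
(`drsr_wave_local_energy_decay_kerr`) from their integrated local energy decay (Thm. 3.2).

## References

* M. Dafermos, I. Rodnianski, Y. Shlapentokh-Rothman, *Decay for solutions of the wave equation
  on Kerr exterior spacetimes III: the full subextremal case `|a| < M`*, Ann. of Math. 183 (2016)
  787–913, arXiv:1402.7034, §2.2.2 (`T`, `Φ` Killing), §3.2 Thm. 3.2 (commuted energies), §4.1
  (reduction to smooth compactly supported data) (key `DafermosRodnianskiShlapentokhrothman2014`).
* R. P. Kerr, A. Schild, 1965, §2 (`g^{μν} = η^{μν} − 2H ℓ^μ ℓ^ν`, `det g = −1`)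
  (key `KerrSchild1965`).
-/

noncomputable section

open Set Filter
open scoped Topology Manifold ContDiff

namespace Literature.Geometry.Lorentzian

/-! ### Calculus lemmas on `E4` -/

/-- `(t, y) ↦ (t, y) ∈ E4` is continuous. [folklore] -/
theorem continuous_uncurry_ofTimeSpace :
    Continuous fun q : ℝ × E3 ↦ E4.ofTimeSpace q.1 q.2 := by
  have : (fun q : ℝ × E3 ↦ E4.ofTimeSpace q.1 q.2) =
      fun q ↦ q.1 • E4.basisVector 0 + E4.spaceEmbed q.2 :=
    funext fun q ↦ E4.ofTimeSpace_eq_smul_add' q.1 q.2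
  rw [this]
  fun_prop

/-- `t ↦ (t, y)` is continuous for fixed `y`. [folklore] -/
theorem continuous_ofTimeSpace_left (y : E3) : Continuous fun t : ℝ ↦ E4.ofTimeSpace t y :=
  continuous_uncurry_ofTimeSpace.comp (continuous_id.prodMk continuous_const)

/-- A function vanishing along a line through `x` (for small parameters) has zero derivative at
`x` in the direction of the line. [folklore] -/
theorem fderiv_apply_eq_zero_of_eventually_eq_zero {F : E4 → ℝ} {x v : E4}
    (hF : DifferentiableAt ℝ F x) (h0 : ∀ᶠ s in 𝓝 (0 : ℝ), F (x + s • v) = 0) :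
    fderiv ℝ F x v = 0 := by
  have h1 : HasLineDerivAt ℝ F (fderiv ℝ F x v) x v := hF.hasFDerivAt.hasLineDerivAt v
  have h2 : HasLineDerivAt ℝ F 0 x v := by
    show HasDerivAt (fun s : ℝ ↦ F (x + s • v)) 0 0
    exact (hasDerivAt_const (0 : ℝ) (0 : ℝ)).congr_of_eventuallyEq h0
  exact h1.unique h2

/-- The derivative of a partial derivative is the second derivative:
`∂_v (y ↦ DF(y) w) (x) = D²F(x)(v)(w)` for `F` of class `C²` at `x`. [folklore] -/
theorem fderiv_fderiv_apply_eq {F : E4 → ℝ} {x : E4} (hF : ContDiffAt ℝ 2 F x) (v w : E4) :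
    fderiv ℝ (fun y ↦ fderiv ℝ F y w) x v = fderiv ℝ (fderiv ℝ F) x v w := by
  have hF2 : DifferentiableAt ℝ (fderiv ℝ F) x :=
    (hF.fderiv_right (m := 1) le_rfl).differentiableAt one_ne_zero
  have h : HasFDerivAt (fun y ↦ fderiv ℝ F y w) ((fderiv ℝ (fderiv ℝ F) x).flip w) x := by
    have := hF2.hasFDerivAt.clm_apply (hasFDerivAt_const w x)
    simpa using this
  rw [h.fderiv, ContinuousLinearMap.flip_apply]

/-- The derivative of the partial derivative `y ↦ DF(y) w` at `x` is `D²F(x)(·)(w)`, for `F`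
of class `C²` at `x`. [folklore] -/
theorem fderiv_partial_eq_flip {F : E4 → ℝ} {x : E4} (hF : ContDiffAt ℝ 2 F x) (w : E4) :
    fderiv ℝ (fun y ↦ fderiv ℝ F y w) x = (fderiv ℝ (fderiv ℝ F) x).flip w := by
  have hF2 : DifferentiableAt ℝ (fderiv ℝ F) x :=
    (hF.fderiv_right (m := 1) le_rfl).differentiableAt one_ne_zero
  have h : HasFDerivAt (fun y ↦ fderiv ℝ F y w) ((fderiv ℝ (fderiv ℝ F) x).flip w) x := by
    have := hF2.hasFDerivAt.clm_apply (hasFDerivAt_const w x)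
    simpa using this
  exact h.fderiv

/-- **Partial derivatives commute** for `F` of class `C²` at `x`:
`∂_v ∂_w F (x) = ∂_w ∂_v F (x)` (symmetry of the second derivative). [folklore] -/
theorem fderiv_fderiv_apply_comm {F : E4 → ℝ} {x : E4} (hF : ContDiffAt ℝ 2 F x) (v w : E4) :
    fderiv ℝ (fun y ↦ fderiv ℝ F y w) x v = fderiv ℝ (fun y ↦ fderiv ℝ F y v) x w := by
  rw [fderiv_fderiv_apply_eq hF, fderiv_fderiv_apply_eq hF]
  exact (hF.isSymmSndFDerivAt (by simp)).eq v w

/-- A partial derivative `y ↦ DF(y) w` of a `C^{n+1}` function is `C^n`. [folklore] -/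
theorem contDiffAt_fderiv_apply_const {F : E4 → ℝ} {x : E4} {n : ℕ∞}
    (hF : ContDiffAt ℝ (n + 1) F x) (w : E4) :
    ContDiffAt ℝ n (fun y ↦ fderiv ℝ F y w) x :=
  (hF.fderiv_right (m := n) le_rfl).clm_apply contDiffAt_const

/-- A partial derivative of a `C^∞` function is `C^∞`. [folklore] -/
theorem contDiffAt_fderiv_apply_const_infty {F : E4 → ℝ} {x : E4}
    (hF : ContDiffAt ℝ ∞ F x) (w : E4) :
    ContDiffAt ℝ ∞ (fun y ↦ fderiv ℝ F y w) x := by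
  rw [contDiffAt_infty] at hF ⊢
  intro n
  have h := contDiffAt_fderiv_apply_const (n := n) (F := F) (x := x)
    (by exact_mod_cast hF (n + 1)) w
  exact_mod_cast h

/-! ### The time derivative `∂_{t*} ψ` of a function on an open subset of `E4` -/

variable {U : TopologicalSpace.Opens E4}

/-- The extension by zero of `ψ : U → ℝ` represents `ψ` on `U`. [folklore] -/
theorem extend_rep (ψ : U → ℝ) (y : U) : ψ y = Function.extend Subtype.val ψ 0 y :=
  (Subtype.val_injective.extend_apply _ _ y).symm

/-- **The time derivative** `Tψ = ∂_{t*} ψ` of a function `ψ` on an open subset `U ⊆ E4` of the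
Kerr–Schild chart: `(Tψ)(x) = Dψ̃(x)(∂_{t*})`, `ψ̃` the extension of `ψ` by zero (which agrees
with `ψ` on the open set `U`, so this is the honest partial derivative `∂_0 ψ`). `T = ∂_{t*}` is
the stationary Killing field of Kerr (Dafermos–Rodnianski–Shlapentokh-Rothman arXiv:1402.7034,
§2.1.1, §2.2.2), used as a commutator: `□_g (Tψ) = T (□_g ψ)`. [cite: DafermosRodnianskiShlapentokhrothman2014, §2.2.2] -/
def timeDeriv (ψ : U → ℝ) : U → ℝ :=
  fun x ↦ fderiv ℝ (Function.extend Subtype.val ψ 0) x (E4.basisVector 0)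

/-- The global partial derivative `x ↦ Dψ̃(x)(∂_{t*})` represents `Tψ` on `U`. [folklore] -/
theorem timeDeriv_rep (ψ : U → ℝ) (y : U) :
    timeDeriv ψ y =
      (fun x : E4 ↦ fderiv ℝ (Function.extend Subtype.val ψ 0) x (E4.basisVector 0)) y := rfl

/-- Smoothness of `ψ : U → ℝ` in the manifold sense gives smoothness of its extension by zero at
every point of `U`. [folklore] -/
theorem contDiffAt_extend {ψ : U → ℝ} {n : ℕ∞ω} (hψ : ContMDiff 𝓘(ℝ, E4) 𝓘(ℝ, ℝ) n ψ) (x : U) :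
    ContDiffAt ℝ n (Function.extend Subtype.val ψ 0) x :=
  (OpensChart.contMDiffAt_iff x ψ _ (extend_rep ψ)).mp (hψ x)

/-- The time derivative of a smooth function is smooth. [folklore] -/
theorem contMDiff_timeDeriv {ψ : U → ℝ} (hψ : ContMDiff 𝓘(ℝ, E4) 𝓘(ℝ, ℝ) ∞ ψ) :
    ContMDiff 𝓘(ℝ, E4) 𝓘(ℝ, ℝ) ∞ (timeDeriv ψ) := fun x ↦
  (OpensChart.contMDiffAt_iff x (timeDeriv ψ)
      (fun x : E4 ↦ fderiv ℝ (Function.extend Subtype.val ψ 0) x (E4.basisVector 0))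
      (timeDeriv_rep ψ)).mpr
    (contDiffAt_fderiv_apply_const_infty (contDiffAt_extend hψ x) _)

/-- On `U`, the extension by zero of `Tψ` agrees near every point with the global partial
derivative `x ↦ Dψ̃(x)(∂_{t*})`. [folklore] -/
theorem extend_timeDeriv_eventuallyEq (ψ : U → ℝ) (x : U) :
    Function.extend Subtype.val (timeDeriv ψ) 0 =ᶠ[𝓝 (x : E4)]
      fun y ↦ fderiv ℝ (Function.extend Subtype.val ψ 0) y (E4.basisVector 0) := by
  filter_upwards [U.isOpen.mem_nhds x.2] with y hy
  exact (extend_rep (timeDeriv ψ) ⟨y, hy⟩).symm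

/-- Hence their derivatives agree on `U`. [folklore] -/
theorem fderiv_extend_timeDeriv (ψ : U → ℝ) (x : U) :
    fderiv ℝ (Function.extend Subtype.val (timeDeriv ψ) 0) x =
      fderiv ℝ (fun y ↦ fderiv ℝ (Function.extend Subtype.val ψ 0) y (E4.basisVector 0)) x :=
  (extend_timeDeriv_eventuallyEq ψ x).fderiv_eq

end Literature.Geometry.Lorentzian

namespace Literature.Geometry.Lorentzian.Kerr

/-! ### `∂_{t*}` commutes with the wave operator in Kerr–Schild coordinates -/

/-- **Stationarity of the principal part**: at a point with `r > 0` where `Φ` is `C²`,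
`∂_0 (∑_ν g^{μν} ∂_νΦ) = ∑_ν g^{μν} ∂_ν(∂_0Φ)` (product rule, `∂_0 g^{μν} = 0`
(`fderiv_inverseMetric_basisVector_zero`) and symmetry of second derivatives).
[cite: KerrSchild1965, §2] -/
theorem fderiv_gradComp_basisVector_zero (M a : ℝ) {Φ : E4 → ℝ} {y : E4} (hy : 0 < radius a y)
    (hΦ : ContDiffAt ℝ 2 Φ y) (μ : Fin 4) :
    fderiv ℝ (fun z ↦ ∑ ν, inverseMetric M a z μ ν * fderiv ℝ Φ z (E4.basisVector ν)) y
        (E4.basisVector 0) =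
      ∑ ν, inverseMetric M a y μ ν *
        fderiv ℝ (fun z ↦ fderiv ℝ Φ z (E4.basisVector 0)) y (E4.basisVector ν) := by
  have hdg : ∀ ν, HasFDerivAt (fun z ↦ inverseMetric M a z μ ν)
      (fderiv ℝ (fun z ↦ inverseMetric M a z μ ν) y) y := fun ν ↦
    ((contDiffAt_inverseMetric M a hy μ ν (n := 1)).differentiableAt one_ne_zero).hasFDerivAt
  have hdΦ : ∀ ν, HasFDerivAt (fun z ↦ fderiv ℝ Φ z (E4.basisVector ν))
      (fderiv ℝ (fun z ↦ fderiv ℝ Φ z (E4.basisVector ν)) y) y := fun ν ↦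
    ((contDiffAt_fderiv_apply_const (n := 1) (by exact_mod_cast hΦ) _).differentiableAt
      one_ne_zero).hasFDerivAt
  have hsum := HasFDerivAt.fun_sum fun ν (_ : ν ∈ Finset.univ) ↦ (hdg ν).mul (hdΦ ν)
  rw [show (fun z ↦ ∑ ν, inverseMetric M a z μ ν * fderiv ℝ Φ z (E4.basisVector ν)) =
      fun z ↦ ∑ ν, ((fun z ↦ inverseMetric M a z μ ν) * fun z ↦ fderiv ℝ Φ z (E4.basisVector ν)) z
      from rfl, hsum.fderiv]
  simp only [sum_apply, add_apply, smul_apply, smul_eq_mul,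
    fderiv_inverseMetric_basisVector_zero M a hy, mul_zero, add_zero]
  refine Finset.sum_congr rfl fun ν _ ↦ ?_
  rw [fderiv_fderiv_apply_comm hΦ]

/-- The first-order part `z ↦ ∑_ν g^{μν}(z) ∂_νΦ(z)` is `C^n` at a point with `r > 0` where `Φ`
is `C^{n+1}`. [folklore] -/
theorem contDiffAt_gradComp (M a : ℝ) {Φ : E4 → ℝ} {y : E4} (hy : 0 < radius a y) {n : ℕ∞}
    (hΦ : ContDiffAt ℝ (n + 1) Φ y) (μ : Fin 4) :
    ContDiffAt ℝ n (fun z ↦ ∑ ν, inverseMetric M a z μ ν * fderiv ℝ Φ z (E4.basisVector ν)) y :=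
  ContDiffAt.sum fun ν _ ↦ (contDiffAt_inverseMetric M a hy μ ν).mul
    (contDiffAt_fderiv_apply_const hΦ _)

/-- **The coordinate wave operator commutes with `∂_{t*}`**: if `r > 0` and `Φ` is `C³` near `x`,
then `∑_μ ∂_μ(∑_ν g^{μν} ∂_ν(∂_0Φ))(x) = ∂_0 (∑_μ ∂_μ(∑_ν g^{μν} ∂_νΦ))(x)` — because the
coefficients `g^{μν}` do not depend on `t*` (Kerr–Schild 1965, §2; DRSR arXiv:1402.7034, §2.2.2:
`T = ∂_{t*}` is Killing, so `[□_g, T] = 0`). [cite: DafermosRodnianskiShlapentokhrothman2014, §2.2.2] -/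
theorem coordWave_partial_zero_comm (M a : ℝ) {Φ : E4 → ℝ} {x : E4}
    (h : ∀ᶠ y in 𝓝 x, 0 < radius a y ∧ ContDiffAt ℝ 3 Φ y) :
    (∑ μ, fderiv ℝ (fun y ↦ ∑ ν, inverseMetric M a y μ ν *
        fderiv ℝ (fun z ↦ fderiv ℝ Φ z (E4.basisVector 0)) y (E4.basisVector ν)) x
          (E4.basisVector μ)) =
      fderiv ℝ (fun y ↦ ∑ μ, fderiv ℝ (fun z ↦ ∑ ν, inverseMetric M a z μ ν *
        fderiv ℝ Φ z (E4.basisVector ν)) y (E4.basisVector μ)) x (E4.basisVector 0) := by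
  obtain ⟨hx, hΦx⟩ := h.self_of_nhds
  -- abbreviation for the first-order parts
  set A : Fin 4 → E4 → ℝ := fun μ z ↦ ∑ ν, inverseMetric M a z μ ν *
    fderiv ℝ Φ z (E4.basisVector ν) with hA
  -- (2) near `x`, `∑_ν g^{μν} ∂_ν(∂_0Φ) = ∂_0 A_μ`
  have h2 : ∀ μ, (fun y ↦ ∑ ν, inverseMetric M a y μ ν *
      fderiv ℝ (fun z ↦ fderiv ℝ Φ z (E4.basisVector 0)) y (E4.basisVector ν)) =ᶠ[𝓝 x]
      fun y ↦ fderiv ℝ (A μ) y (E4.basisVector 0) := by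
    intro μ
    filter_upwards [h] with y hy
    rw [hA]
    exact (fderiv_gradComp_basisVector_zero M a hy.1 (hy.2.of_le (by norm_num)) μ).symm
  -- `A_μ` is `C²` at `x`
  have hA2 : ∀ μ, ContDiffAt ℝ 2 (A μ) x := fun μ ↦
    contDiffAt_gradComp M a hx (n := 2) (by exact_mod_cast hΦx) μ
  -- (3) `∂_μ ∂_0 A_μ = ∂_0 ∂_μ A_μ` at `x`
  have h3 : ∀ μ, fderiv ℝ (fun y ↦ ∑ ν, inverseMetric M a y μ ν *
      fderiv ℝ (fun z ↦ fderiv ℝ Φ z (E4.basisVector 0)) y (E4.basisVector ν)) x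
        (E4.basisVector μ) =
      fderiv ℝ (fun y ↦ fderiv ℝ (A μ) y (E4.basisVector μ)) x (E4.basisVector 0) := by
    intro μ
    rw [(h2 μ).fderiv_eq, fderiv_fderiv_apply_comm (hA2 μ)]
  -- (4) sum over `μ`
  have hd : ∀ μ, HasFDerivAt (fun y ↦ fderiv ℝ (A μ) y (E4.basisVector μ))
      (fderiv ℝ (fun y ↦ fderiv ℝ (A μ) y (E4.basisVector μ)) x) x := fun μ ↦
    ((contDiffAt_fderiv_apply_const (n := 1) (by exact_mod_cast hA2 μ) _).differentiableAt
      one_ne_zero).hasFDerivAt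
  have hsum := HasFDerivAt.fun_sum fun μ (_ : μ ∈ Finset.univ) ↦ hd μ
  simp only [h3]
  rw [hsum.fderiv, sum_apply]

/-- **`□_g (Tψ) = 0` for solutions**: if `ψ` is smooth on a Kerr–Schild chart domain and
`□_g ψ = 0` there, then its time derivative `Tψ = ∂_{t*}ψ` solves the wave equation as well
(`T` is a Killing field of `g_{M,a}`, DRSR arXiv:1402.7034, §2.2.2; here via the divergence form
`□_g = ∑ ∂_μ g^{μν} ∂_ν` in Kerr–Schild coordinates, `Kerr.dalembertian_eq_divergence`, and
`∂_{t*} g^{μν} = 0`). [cite: DafermosRodnianskiShlapentokhrothman2014, §2.2.2] -/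
theorem dalembertian_timeDeriv_eq_zero [Facts] [SliceFacts] (M a r₀ : ℝ) {ψ : region a r₀ → ℝ}
    (hψ : ContMDiff 𝓘(ℝ, E4) 𝓘(ℝ, ℝ) ∞ ψ)
    (hsol : ∀ x, (smoothMetric M a r₀).toPseudoRiemannianMetric.dalembertian ψ x = 0)
    (x : region a r₀) :
    (smoothMetric M a r₀).toPseudoRiemannianMetric.dalembertian (timeDeriv ψ) x = 0 := by
  set Φ : E4 → ℝ := Function.extend Subtype.val ψ 0 with hΦ
  have hsmooth : ∀ y : region a r₀, ContDiffAt ℝ ∞ Φ y := fun y ↦ contDiffAt_extend hψ y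
  have hΦ₀2 : ContDiffAt ℝ 2 (fun y ↦ fderiv ℝ Φ y (E4.basisVector 0)) x :=
    contDiffAt_fderiv_apply_const (n := 2) ((hsmooth x).of_le (by norm_cast)) _
  rw [dalembertian_eq_divergence M a r₀ (ψ := timeDeriv ψ) (timeDeriv_rep ψ) x hΦ₀2]
  have hnhds : ∀ᶠ y in 𝓝 (x : E4), 0 < radius a y ∧ ContDiffAt ℝ 3 Φ y := by
    filter_upwards [(region a r₀).isOpen.mem_nhds x.2] with y hy
    exact ⟨radius_pos_of_mem_region hy, (hsmooth ⟨y, hy⟩).of_le (by norm_cast)⟩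
  rw [coordWave_partial_zero_comm M a hnhds]
  -- the coordinate wave expression of `Φ` vanishes identically near `x`
  have hW : (fun y ↦ ∑ μ, fderiv ℝ (fun z ↦ ∑ ν, inverseMetric M a z μ ν *
      fderiv ℝ Φ z (E4.basisVector ν)) y (E4.basisVector μ)) =ᶠ[𝓝 (x : E4)] fun _ ↦ 0 := by
    filter_upwards [(region a r₀).isOpen.mem_nhds x.2] with y hy
    have := dalembertian_eq_divergence M a r₀ (ψ := ψ) (extend_rep ψ) ⟨y, hy⟩
      ((hsmooth ⟨y, hy⟩).of_le (by norm_cast))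
    rw [← this]
    exact hsol ⟨y, hy⟩
  rw [hW.fderiv_eq]
  simp

end Literature.Geometry.Lorentzian.Kerr

namespace Literature.Geometry.Lorentzian.Kerr

/-! ### Data of `Tψ`: all second derivatives vanish at data-free points of the slice -/

/-- **Vanishing of the data along spatial lines.** If the data `(ψ, dψ)` of a `C^n` function
(`n ≥ 1`) on a chart domain vanish at the points of the slice `{t* = 0}` outside a compact set `K`,
then for a slice point `x ∉ K` and a spatial direction `v` (`v⁰ = 0`), the representative `ψ̃` and
its derivative vanish at `x + s v` for all small `s` (the data-free part of the slice is relatively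
open). [folklore] -/
theorem eventually_extend_eq_zero_of_data {a r₀ : ℝ} {ψ : region a r₀ → ℝ} {n : ℕ∞ω} (hn : n ≠ 0)
    (hψ : ContMDiff 𝓘(ℝ, E4) 𝓘(ℝ, ℝ) n ψ) {K : Set (region a r₀)} (hK : IsCompact K)
    (hdata : ∀ x : region a r₀, (x : E4) 0 = 0 → x ∉ K →
      ψ x = 0 ∧ mfderiv 𝓘(ℝ, E4) 𝓘(ℝ, ℝ) ψ x = 0)
    {x : region a r₀} (hx0 : (x : E4) 0 = 0) (hxK : x ∉ K) {v : E4} (hv : v 0 = 0) :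
    ∀ᶠ s in 𝓝 (0 : ℝ), Function.extend Subtype.val ψ 0 ((x : E4) + s • v) = 0 ∧
      fderiv ℝ (Function.extend Subtype.val ψ 0) ((x : E4) + s • v) = 0 := by
  -- the open set `region ∖ K`
  have hKc : IsClosed (Subtype.val '' K : Set E4) :=
    (hK.image continuous_subtype_val).isClosed
  have hG : IsOpen ((region a r₀ : Set E4) ∩ (Subtype.val '' K)ᶜ) :=
    (region a r₀).isOpen.inter hKc.isOpen_compl
  have hxG : (x : E4) ∈ (region a r₀ : Set E4) ∩ (Subtype.val '' K)ᶜ := by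
    refine ⟨x.2, fun ⟨z, hz, hzx⟩ ↦ hxK ?_⟩
    rwa [← Subtype.ext hzx]
  have hc : Continuous fun s : ℝ ↦ (x : E4) + s • v := by fun_prop
  have hev : ∀ᶠ s in 𝓝 (0 : ℝ), (x : E4) + s • v ∈ (region a r₀ : Set E4) ∩ (Subtype.val '' K)ᶜ :=
    hc.continuousAt.eventually_mem (hG.mem_nhds (by simpa using hxG))
  filter_upwards [hev] with s hs
  set z : region a r₀ := ⟨(x : E4) + s • v, hs.1⟩ with hz
  have hzK : z ∉ K := fun h ↦ hs.2 ⟨z, h, rfl⟩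
  have hz0 : (z : E4) 0 = 0 := by simp [hz, hx0, hv]
  obtain ⟨hψz, hdz⟩ := hdata z hz0 hzK
  exact ⟨(extend_rep ψ z) ▸ hψz, fderiv_extend_eq_zero hn hψ z hdz⟩

/-- `g^{00} = −1 − 2H` in Kerr–Schild coordinates (`ℓ⁰ = −ℓ₀ = −1`). Kerr–Schild 1965, §2.
[cite: KerrSchild1965, §2] -/
theorem inverseMetric_zero_zero (M a : ℝ) (x : E4) :
    inverseMetric M a x 0 0 = -1 - 2 * scalarH M a x := by
  rw [inverseMetric_apply, nullVector_apply]
  simp [nullCovectorFun]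

/-- `g^{00} = −1 − 2H ≠ 0` for `M ≥ 0` (then `H ≥ 0`): the slices `{t* = const}` are spacelike.
Kerr–Schild 1965, §2. [cite: KerrSchild1965, §2] -/
theorem inverseMetric_zero_zero_ne_zero {M : ℝ} (hM : 0 ≤ M) (a : ℝ) (x : E4) :
    inverseMetric M a x 0 0 ≠ 0 := by
  rw [inverseMetric_zero_zero]
  have := scalarH_nonneg hM a x
  linarith

/-- **All second derivatives vanish at data-free slice points.** For a smooth solution of
`□_g ψ = 0` (`M ≥ 0`) whose data vanish on the slice `{t* = 0}` outside a compact `K`, the full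
second derivative `D²ψ̃(x)` vanishes at every slice point `x ∉ K`: spatial derivatives of the
(vanishing) first derivatives vanish, mixed ones by symmetry, and `∂_0²ψ̃(x) = 0` from the wave
equation, in which only the term `g^{00} ∂_0²ψ̃` survives and `g^{00} = −1 − 2H ≠ 0`. (So the data
of `Tψ` vanish outside the same `K`.) [folklore] -/
theorem fderiv_fderiv_extend_eq_zero_of_data [Facts] [SliceFacts] {M : ℝ} (hM : 0 ≤ M) (a r₀ : ℝ)
    {ψ : region a r₀ → ℝ} (hψ : ContMDiff 𝓘(ℝ, E4) 𝓘(ℝ, ℝ) ∞ ψ)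
    (hsol : ∀ x, (smoothMetric M a r₀).toPseudoRiemannianMetric.dalembertian ψ x = 0)
    {K : Set (region a r₀)} (hK : IsCompact K)
    (hdata : ∀ x : region a r₀, (x : E4) 0 = 0 → x ∉ K →
      ψ x = 0 ∧ mfderiv 𝓘(ℝ, E4) 𝓘(ℝ, ℝ) ψ x = 0)
    {x : region a r₀} (hx0 : (x : E4) 0 = 0) (hxK : x ∉ K) :
    fderiv ℝ (fderiv ℝ (Function.extend Subtype.val ψ 0)) x = 0 := by
  set Φ : E4 → ℝ := Function.extend Subtype.val ψ 0 with hΦ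
  have hΦx : ContDiffAt ℝ ∞ Φ x := contDiffAt_extend hψ x
  have hΦ2 : ContDiffAt ℝ 2 Φ x := hΦx.of_le (by norm_cast)
  -- spatial derivatives of first derivatives vanish
  have hsp : ∀ i : Fin 4, i ≠ 0 → ∀ w : E4,
      fderiv ℝ (fderiv ℝ Φ) x (E4.basisVector i) w = 0 := by
    intro i hi w
    rw [← fderiv_fderiv_apply_eq hΦ2]
    refine fderiv_apply_eq_zero_of_eventually_eq_zero
      ((contDiffAt_fderiv_apply_const (n := 1) (hΦx.of_le (by norm_cast)) w).differentiableAt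
        one_ne_zero) ?_
    have hv : (E4.basisVector i : E4) 0 = 0 := by
      simp [E4.basisVector, hi.symm]
    filter_upwards [eventually_extend_eq_zero_of_data (by simp) hψ hK hdata hx0 hxK hv]
      with s hs
    have h2 := hs.2
    rw [← hΦ] at h2
    simp [h2]
  have hsymm : ∀ v w, fderiv ℝ (fderiv ℝ Φ) x v w = fderiv ℝ (fderiv ℝ Φ) x w v :=
    fun v w ↦ (hΦ2.isSymmSndFDerivAt (by simp)).eq v w
  have hsp' : ∀ i : Fin 4, i ≠ 0 → ∀ v : E4,
      fderiv ℝ (fderiv ℝ Φ) x v (E4.basisVector i) = 0 := fun i hi v ↦ by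
    rw [hsymm]; exact hsp i hi v
  -- the basis entries other than `(0,0)` vanish
  have hoff : ∀ μ ν : Fin 4, ¬ (μ = 0 ∧ ν = 0) →
      fderiv ℝ (fderiv ℝ Φ) x (E4.basisVector μ) (E4.basisVector ν) = 0 := by
    intro μ ν h
    by_cases hμ : μ = 0
    · have hν : ν ≠ 0 := fun hν ↦ h ⟨hμ, hν⟩
      exact hsp' ν hν _
    · exact hsp μ hμ _
  -- the `(0,0)` entry, from the wave equation
  have hdΦ : fderiv ℝ Φ x = 0 := fderiv_extend_eq_zero (by simp) hψ x (hdata x hx0 hxK).2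
  have h00 : fderiv ℝ (fderiv ℝ Φ) x (E4.basisVector 0) (E4.basisVector 0) = 0 := by
    have hw := hsol x
    rw [dalembertian_eq_sum M a r₀ (extend_rep ψ) x hΦ2] at hw
    rw [← hΦ] at hw
    simp only [hdΦ, zero_apply, sub_zero] at hw
    rw [Finset.sum_eq_single (0 : Fin 4) (fun μ _ hμ ↦ ?_) (by simp),
      Finset.sum_eq_single (0 : Fin 4) (fun ν _ hν ↦ ?_) (by simp)] at hw
    · exact (mul_eq_zero.mp hw).resolve_left (inverseMetric_zero_zero_ne_zero hM a x)
    · rw [hoff 0 ν (fun h ↦ hν h.2), mul_zero]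
    · exact Finset.sum_eq_zero fun ν _ ↦ by rw [hoff μ ν (fun h ↦ hμ h.1), mul_zero]
  -- assemble
  have hall : ∀ μ ν : Fin 4,
      fderiv ℝ (fderiv ℝ Φ) x (E4.basisVector μ) (E4.basisVector ν) = 0 := by
    intro μ ν
    by_cases h : μ = 0 ∧ ν = 0
    · obtain ⟨rfl, rfl⟩ := h
      exact h00
    · exact hoff μ ν h
  ext v w
  conv_lhs => rw [eq_sum_basisVector v, map_sum, sum_apply, eq_sum_basisVector w]
  simp [map_sum, hall]

end Literature.Geometry.Lorentzian.Kerr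

namespace Literature.Geometry.Lorentzian

/-- **The time derivative of an admissible wave is an admissible wave** (`M ≥ 0`): `Tψ` is
smooth, solves `□_g (Tψ) = 0` (`Kerr.dalembertian_timeDeriv_eq_zero`), and its data
`(Tψ, d(Tψ)) = (∂_0ψ̃, (∂_μ∂_0ψ̃)_μ)` vanish on the slice `{t* = 0}` outside the same compact set
as the data of `ψ` (`Kerr.fderiv_fderiv_extend_eq_zero_of_data`). This is the commutation by the
Killing field `T` used throughout DRSR (arXiv:1402.7034, §2.2.2, Thm. 3.2).
[cite: DafermosRodnianskiShlapentokhrothman2014, §2.2.2] -/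
theorem IsAdmissibleKerrWave.timeDeriv [Kerr.Facts] [Kerr.SliceFacts] {M a : ℝ} (hM : 0 ≤ M)
    {ψ : Kerr.exterior M a → ℝ} (hψ : IsAdmissibleKerrWave M a ψ) :
    IsAdmissibleKerrWave M a (timeDeriv ψ) := by
  obtain ⟨hsmooth, hsol, K, hK, hdata⟩ := hψ
  refine ⟨contMDiff_timeDeriv hsmooth, Kerr.dalembertian_timeDeriv_eq_zero M a _ hsmooth hsol,
    K, hK, fun x hx0 hxK ↦ ?_⟩
  set Φ : E4 → ℝ := Function.extend Subtype.val ψ 0 with hΦ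
  have hdΦ : fderiv ℝ Φ x = 0 :=
    Kerr.fderiv_extend_eq_zero (by simp) hsmooth x (hdata x hx0 hxK).2
  have hΦ2 : ContDiffAt ℝ 2 Φ x := (contDiffAt_extend hsmooth x).of_le (by norm_cast)
  refine ⟨by simp [Literature.Geometry.Lorentzian.timeDeriv, ← hΦ, hdΦ], ?_⟩
  have hdiff : DifferentiableAt ℝ (fun y ↦ fderiv ℝ Φ y (E4.basisVector 0)) x :=
    (contDiffAt_fderiv_apply_const (n := 1) (by exact_mod_cast hΦ2) _).differentiableAt
      one_ne_zero
  have hD2 : fderiv ℝ (fderiv ℝ Φ) x = 0 :=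
    Kerr.fderiv_fderiv_extend_eq_zero_of_data hM a _ hsmooth hsol hK hdata hx0 hxK
  have hzero : fderiv ℝ (fun y ↦ fderiv ℝ Φ y (E4.basisVector 0)) x = 0 := by
    rw [fderiv_partial_eq_flip hΦ2, hD2]
    simp
  rw [OpensChart.mfderiv_eq x (Literature.Geometry.Lorentzian.timeDeriv ψ) _ (timeDeriv_rep ψ)
    hdiff]
  exact hzero

end Literature.Geometry.Lorentzian

namespace Literature.Geometry.Lorentzian

open MeasureTheory
open scoped ENNReal

/-! ### Finiteness of the second-order initial energy of admissible waves -/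

/-- **The second-order coordinate energy of the data of an admissible wave is finite**
(`M ≥ 0`): on the slice `{t* = 0}` the integrand `∑_{m ≤ 2} ‖D^m ψ̃‖²` of
`sliceSobolevEnergy … ψ 0 2 0 univ` is continuous on the compact support set `K` of the data and
vanishes outside it (`ψ̃ = dψ̃ = 0` by assumption, `D²ψ̃ = 0` by
`Kerr.fderiv_fderiv_extend_eq_zero_of_data`), so the energy is at most `(sup_K ∑ ‖D^m ψ̃‖²) ·
vol(B_ρ)` with `K ⊆ {‖y‖ ≤ ρ}`. This is the finiteness "`E < ∞` for smooth compactly supported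
data" invoked in the consequence forms of DRSR's estimates (arXiv:1402.7034, §4.1).
[cite: DafermosRodnianskiShlapentokhrothman2014, §4.1] -/
theorem IsAdmissibleKerrWave.sliceSobolevEnergy_two_lt_top [Kerr.Facts] [Kerr.SliceFacts]
    {M a : ℝ} (hM : 0 ≤ M) {ψ : Kerr.region a (Kerr.rPlus M a) → ℝ}
    (hψ : IsAdmissibleKerrWave M a ψ) :
    sliceSobolevEnergy (Kerr.exterior M a) ψ 0 2 0 univ < ⊤ := by
  obtain ⟨hsmooth, hsol, K, hK, hdata⟩ := hψ
  set Φ : E4 → ℝ := Function.extend Subtype.val ψ 0 with hΦ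
  set S : E4 → ℝ := fun x ↦ ∑ m ∈ Finset.range (2 + 1), ‖iteratedFDeriv ℝ m Φ x‖ ^ 2 with hS
  -- `S` is continuous on the compact `K`, hence bounded there
  have hKc : IsCompact (Subtype.val '' K : Set E4) := hK.image continuous_subtype_val
  have hScont : ContinuousOn S (Subtype.val '' K) := by
    rintro _ ⟨z, hz, rfl⟩
    refine ContinuousAt.continuousWithinAt (tendsto_finsetSum _ fun m _ ↦ ?_)
    exact (((contDiffAt_extend hsmooth z).continuousAt_iteratedFDeriv (k := m)
      (by exact_mod_cast le_top)).norm.pow 2)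
  obtain ⟨B, hB⟩ := hKc.exists_bound_of_continuousOn hScont
  obtain ⟨ρ, -, hρ⟩ := exists_spatialNorm_le_of_isCompact hK
  -- `S` vanishes at data-free slice points
  have hSzero : ∀ x : Kerr.region a (Kerr.rPlus M a), (x : E4) 0 = 0 → x ∉ K → S x = 0 := by
    intro x hx0 hxK
    have h0 : Φ x = 0 := by rw [hΦ, ← extend_rep ψ x]; exact (hdata x hx0 hxK).1
    have h1 : fderiv ℝ Φ x = 0 := Kerr.fderiv_extend_eq_zero (by simp) hsmooth x (hdata x hx0 hxK).2
    have h2 : fderiv ℝ (fderiv ℝ Φ) x = 0 :=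
      Kerr.fderiv_fderiv_extend_eq_zero_of_data hM a _ hsmooth hsol hK hdata hx0 hxK
    rw [hS]
    simp only [Finset.sum_range_succ, Finset.sum_range_zero, zero_add, norm_iteratedFDeriv_zero,
      h0, norm_zero, norm_iteratedFDeriv_one, h1]
    rw [← norm_iteratedFDeriv_fderiv, norm_iteratedFDeriv_one, h2, norm_zero]
    norm_num
  -- pointwise bound of the integrand
  have hpt : ∀ y : E3,
      {y : E3 | E4.ofTimeSpace 0 y ∈ Kerr.exterior M a}.indicator
          (fun y ↦ ENNReal.ofReal ((1 + ‖y‖) ^ (0 : ℝ) * S (E4.ofTimeSpace 0 y))) y ≤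
        (Metric.closedBall (0 : E3) ρ).indicator (fun _ ↦ ENNReal.ofReal B) y := by
    intro y
    by_cases hmem : E4.ofTimeSpace 0 y ∈ Kerr.exterior M a
    · rw [indicator_of_mem (show y ∈ {y : E3 | E4.ofTimeSpace 0 y ∈ Kerr.exterior M a} from hmem),
        Real.rpow_zero, one_mul]
      set x : Kerr.region a (Kerr.rPlus M a) := ⟨E4.ofTimeSpace 0 y, hmem⟩ with hx
      by_cases hxK : x ∈ K
      · have hyρ : y ∈ Metric.closedBall (0 : E3) ρ := by
          rw [Metric.mem_closedBall, dist_zero_right, ← E4.spatialNorm_ofTimeSpace 0 y]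
          exact hρ x hxK
        rw [indicator_of_mem hyρ]
        refine ENNReal.ofReal_le_ofReal ((le_abs_self _).trans ?_)
        have := hB _ ⟨x, hxK, rfl⟩
        rwa [Real.norm_eq_abs] at this
      · rw [hSzero x (by simp [hx]) hxK, ENNReal.ofReal_zero]
        exact zero_le
    · rw [indicator_of_notMem
        (show y ∉ {y : E3 | E4.ofTimeSpace 0 y ∈ Kerr.exterior M a} from hmem)]
      exact zero_le
  calc sliceSobolevEnergy (Kerr.exterior M a) ψ 0 2 0 univ
      ≤ ∫⁻ y in univ, (Metric.closedBall (0 : E3) ρ).indicator (fun _ ↦ ENNReal.ofReal B) y :=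
        lintegral_mono hpt
    _ ≤ ENNReal.ofReal B * volume (Metric.closedBall (0 : E3) ρ) := by
        rw [Measure.restrict_univ]
        exact lintegral_indicator_const_le _ _
    _ < ⊤ := ENNReal.mul_lt_top ENNReal.ofReal_lt_top measure_closedBall_lt_top

/-! ### Measurability of the coordinate energies -/

variable (U : TopologicalSpace.Opens E4) (ψ : U → ℝ)

/-- The space-time integrand of the coordinate energies:
`(t, y) ↦ 𝟙_{(t,y) ∈ U} ∑_μ (∂_μψ̃)²(t, y)`. [folklore] -/
def energyIntegrand (q : ℝ × E3) : ℝ≥0∞ :=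
  {q : ℝ × E3 | E4.ofTimeSpace q.1 q.2 ∈ U}.indicator
    (fun q ↦ ENNReal.ofReal (coordEnergyDensity U ψ (E4.ofTimeSpace q.1 q.2))) q

/-- The space-time energy integrand is (jointly Borel) measurable — for *any* `ψ`: the
derivative of an arbitrary function is measurable (`measurable_fderiv_apply_const`). [folklore] -/
theorem measurable_energyIntegrand : Measurable (energyIntegrand U ψ) := by
  refine Measurable.indicator ?_ (U.isOpen.preimage continuous_uncurry_ofTimeSpace).measurableSet
  refine ENNReal.measurable_ofReal.comp ?_
  unfold coordEnergyDensity
  refine Finset.measurable_sum _ fun μ _ ↦ Measurable.pow_const ?_ _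
  exact (measurable_fderiv_apply_const ℝ (Function.extend Subtype.val ψ (0 : E4 → ℝ))
    (EuclideanSpace.single μ (1 : ℝ))).comp continuous_uncurry_ofTimeSpace.measurable

/-- On the chart domain the integrand is the energy density. [folklore] -/
theorem energyIntegrand_of_mem {t : ℝ} {y : E3} (h : E4.ofTimeSpace t y ∈ U) :
    energyIntegrand U ψ (t, y) = ENNReal.ofReal (coordEnergyDensity U ψ (E4.ofTimeSpace t y)) :=
  indicator_of_mem (show (t, y) ∈ {q : ℝ × E3 | E4.ofTimeSpace q.1 q.2 ∈ U} from h) _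

/-- Off the chart domain the integrand vanishes. [folklore] -/
theorem energyIntegrand_of_not_mem {t : ℝ} {y : E3} (h : E4.ofTimeSpace t y ∉ U) :
    energyIntegrand U ψ (t, y) = 0 :=
  indicator_of_notMem (show (t, y) ∉ {q : ℝ × E3 | E4.ofTimeSpace q.1 q.2 ∈ U} from h) _

/-- The local energy is the `y`-integral of the space-time integrand over the ball. [folklore] -/
theorem localSliceEnergy_eq_lintegral_energyIntegrand (τ R : ℝ) :
    localSliceEnergy U ψ τ R =
      ∫⁻ y in Metric.closedBall (0 : E3) R, energyIntegrand U ψ (τ, y) := rfl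

/-- `τ ↦ E_loc(τ, R)` is measurable. [folklore] -/
theorem measurable_localSliceEnergy (R : ℝ) :
    Measurable fun τ : ℝ ↦ localSliceEnergy U ψ τ R := by
  simp only [localSliceEnergy_eq_lintegral_energyIntegrand]
  exact (measurable_energyIntegrand U ψ).lintegral_prod_right'

end Literature.Geometry.Lorentzian

end
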